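import Summits.ResolutionOfSingularities.ResolutionOfSingularities.Theorems.HomologicalConductorNoZenoSelfIntersectionBound
import HarnessLib

/-!
# Crux `NoZenoR` (stmt-ResolutionOfSingularities-19943), facts slot `stub_publishedSurfaceFactsW3`:
# Lipman (27.3) «⇐» REDUCED TO ITS PRINT CONTENT — the first-kind-curve clause of a non-isomorphic contraction

Route `ResolutionOfSingularities/HomologicalConductor` (cell decomp-res, hand leafhand-res-homologicalconduct-7 g0).
OURS: AI-written bookkeeping, weaker than expert review; nothing here is a statement of the manuscript under review
(Hironaka 2017).  SUPPORT level, counted 0.  Def-free, no new named facts; fact-parametric in typed Lipman facts.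

With `…NoZenoMinimalNoFirstKind` (p811458) and `…NoZenoSelfIntersectionBound` (p811603) the «⇒» half of the named fact
`Lipman1969_27_3_rat` is a consequence of `Lipman1969_27_1_reg_rat`, `Lipman1969_13_1_a`, `Lipman1969_13_1_d_rat`,
`Lipman1969_14_1`.  This file isolates what the «⇐» half («(M) for every integral exceptional curve ⇒ `π` is the minimal
desingularization») costs beyond `Lipman1969_4_1` (existence of the minimal desingularization of `Spec S`): EXACTLY the
clause (F) «a NON-isomorphic `S`-morphism from `X` to another desingularization of `Spec S` contracts some integral
exceptional curve of `π` OF THE FIRST KIND, `h⁰(𝓘_η²) = 3·h⁰(𝓘_η)`» — Lipman's p. 277 argument (the morphism is a product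
of quadratic transformations by Theorem (4.1); the exceptional curve of the last one has `(E²) = −h⁰(E)`, cf. the tree's
`PointBlowupH0.h0_comap_sq_eq_three_mul`), i.e. the untyped factorisation clause of (4.1).  (F) enters as an explicit
HYPOTHESIS BINDER (no definition, no fact is declared):

* `isMinimalResolution_of_criterionM_of_firstKindClause` — (4.1) + (F) + (M) everywhere ⇒ `π` minimal;
* `isMinimalResolution_iff_criterionM_of_facts` — the full biconditional of (27.3) from (27.1), (13.1) a), d), (14.1),
  (4.1) and (F).

So, for the W3 print-debt census: `Lipman1969_27_3_rat` ⟸ {(27.1), (13.1) a), (13.1) d), (14.1), (4.1)} ∪ {(F)}, all but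
(F) typed named facts of the tree, (F) = Zariski–Lipman factorisation read at the last blow-up.  No crux or summit
statement is proved here.
-/

noncomputable section

-- single-problem summit: the doubled namespace component `ResolutionOfSingularities` is forced
set_option linter.dupNamespace false

open CategoryTheory AlgebraicGeometry IsLocalRing
open Literature.AlgebraicGeometry.Resolution

universe u

namespace Summit.ResolutionOfSingularities.ResolutionOfSingularities.Theorems.NoZeno.ExcCount.MinimalNoFirstKind

variable {S : Type u} [CommRing S] [IsNoetherianRing S] [IsLocalRing S] [IsDomain S] [IsIntegrallyClosed S]
  {X : Scheme.{u}} {π : X ⟶ Spec (.of S)}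

/-- **Lipman (27.3) «⇐» modulo (4.1) and the first-kind clause (F).**  Let `π : X → Spec S` be a desingularization of a
two-dimensional normal Noetherian local domain with a rational singularity such that every integral exceptional curve
satisfies (M) `3·h⁰(𝓘_η) < h⁰(𝓘_η²)`.  Granting (4.1) (a minimal desingularization `g : Y → Spec S` exists, tree
`Lipman1969_4_1.exists_isMinimalResolution_Spec`) and (F) (every non-isomorphic `S`-morphism `X → Y'` to a
desingularization contracts a first-kind curve of `π`), `π` is minimal: the factorisation `h : X → Y` is an isomorphism —
otherwise (F) produces `η` with `h⁰(𝓘_η²) = 3·h⁰(𝓘_η)`, against (M) — and a desingularization isomorphic over the base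
to a minimal one is minimal (`isMinimalResolution_of_iso_comp`).
[cite: Lipman1969, Corollary (27.3) (p. 277; proof pp. 277–278) and Theorem (4.1) (p. 204)] -/
theorem isMinimalResolution_of_criterionM_of_firstKindClause (h41 : Lipman1969_4_1.{u})
    (h2 : ringKrullDim S = 2) (hS : HasRationalSingularity S) (hπ : IsResolution π)
    (hF : ∀ (Y : Scheme.{u}) (g : Y ⟶ Spec (.of S)) (h : X ⟶ Y), IsResolution g → h ≫ g = π → ¬ IsIso h →
      ∃ η ∈ excCurvePoints π, h0 π (primeDivisorIdeal η ^ 2) = 3 * h0 π (primeDivisorIdeal η))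
    (hM : ∀ η ∈ excCurvePoints π, 3 * h0 π (primeDivisorIdeal η) < h0 π (primeDivisorIdeal η ^ 2)) :
    IsMinimalResolution π := by
  obtain ⟨Y, g, hg⟩ := Lipman1969_4_1.exists_isMinimalResolution_Spec h41 S h2 hS
  obtain ⟨h, hh⟩ := hg.2 X π hπ
  by_cases hiso : IsIso h
  · exact isMinimalResolution_of_iso_comp hg h hh hπ
  · obtain ⟨η, hη, heq⟩ := hF Y g h hg.1 hh hiso
    exact absurd heq (ne_of_gt (hM η hη))

/-- **Lipman (27.3), both directions, from typed facts and the first-kind clause (F)**: for a desingularization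
`π : X → Spec S` of a two-dimensional normal Noetherian local domain with a rational singularity,
`IsMinimalResolution π ↔ ∀ η ∈ excCurvePoints π, 3·h⁰(𝓘_η) < h⁰(𝓘_η²)` — «⇒» from (27.1), (13.1) a), d), (14.1)
(`three_mul_h0_lt_h0_sq_of_isMinimalResolution`), «⇐» from (4.1) and (F)
(`isMinimalResolution_of_criterionM_of_firstKindClause`).  This is the shape of the named fact `Lipman1969_27_3_rat` at
`(S, X, π)`; its remaining print content is (F).
[cite: Lipman1969, Corollary (27.3) (p. 277), Theorem (27.1) (p. 275), Theorem (4.1) (p. 204), Proposition (13.1) (p. 223), Lemma (14.1) (p. 224)] -/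
theorem isMinimalResolution_iff_criterionM_of_facts (h271 : Lipman1969_27_1_reg_rat.{u})
    (h131a : Lipman1969_13_1_a.{u}) (h131d : Lipman1969_13_1_d_rat.{u}) (h141 : Lipman1969_14_1.{u})
    (h41 : Lipman1969_4_1.{u}) (h2 : ringKrullDim S = 2) (hS : HasRationalSingularity S) (hπ : IsResolution π)
    (hF : ∀ (Y : Scheme.{u}) (g : Y ⟶ Spec (.of S)) (h : X ⟶ Y), IsResolution g → h ≫ g = π → ¬ IsIso h →
      ∃ η ∈ excCurvePoints π, h0 π (primeDivisorIdeal η ^ 2) = 3 * h0 π (primeDivisorIdeal η)) :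
    IsMinimalResolution π ↔
      ∀ η ∈ excCurvePoints π, 3 * h0 π (primeDivisorIdeal η) < h0 π (primeDivisorIdeal η ^ 2) :=
  ⟨fun hmin _η hη => three_mul_h0_lt_h0_sq_of_isMinimalResolution h271 h131a h131d h141 h2 hS hmin hη,
    fun hM => isMinimalResolution_of_criterionM_of_firstKindClause h41 h2 hS hπ hF hM⟩

/-! ## Appendix (same hand): (13.1) a) is the tree theorem `Lipman1969_13_1_a_holds` — the biconditional without that binder. -/

/-- **Lipman (27.3), both directions, from (27.1), (13.1) d), (14.1), (4.1) and the first-kind clause (F)** ((13.1) a)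
discharged by the tree theorem `Lipman1969_13_1_a_holds` through `three_mul_h0_lt_h0_sq_of_isMinimalResolution'`).
[cite: Lipman1969, Corollary (27.3) (p. 277), Theorem (27.1) (p. 275), Theorem (4.1) (p. 204), Lemma (14.1) (p. 224)] -/
theorem isMinimalResolution_iff_criterionM_of_facts' (h271 : Lipman1969_27_1_reg_rat.{u})
    (h131d : Lipman1969_13_1_d_rat.{u}) (h141 : Lipman1969_14_1.{u}) (h41 : Lipman1969_4_1.{u})
    (h2 : ringKrullDim S = 2) (hS : HasRationalSingularity S) (hπ : IsResolution π)
    (hF : ∀ (Y : Scheme.{u}) (g : Y ⟶ Spec (.of S)) (h : X ⟶ Y), IsResolution g → h ≫ g = π → ¬ IsIso h →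
      ∃ η ∈ excCurvePoints π, h0 π (primeDivisorIdeal η ^ 2) = 3 * h0 π (primeDivisorIdeal η)) :
    IsMinimalResolution π ↔
      ∀ η ∈ excCurvePoints π, 3 * h0 π (primeDivisorIdeal η) < h0 π (primeDivisorIdeal η ^ 2) :=
  ⟨fun hmin _η hη => three_mul_h0_lt_h0_sq_of_isMinimalResolution' h271 h131d h141 h2 hS hmin hη,
    fun hM => isMinimalResolution_of_criterionM_of_firstKindClause h41 h2 hS hπ hF hM⟩

end Summit.ResolutionOfSingularities.ResolutionOfSingularities.Theorems.NoZeno.ExcCount.MinimalNoFirstKind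

end
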